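import Summits.RiemannHypothesis.RiemannHypothesis.Theorems.TwoPrimeFoldRigidity.Negative.MBTCubedGon

/-!
# One-lattice moment-blind towers, part 2: level geometry

HONEST LABEL.  Negative-side helper toward `¬ IntegerScrew.TwoPrimeFoldRigidity` (item stmt-RiemannHypothesis-25784);
record-negative programme; 0 toward RH.  RH is not proved, not used, not mentioned below.
Nothing here bears on the truth of RH.

Elementary inequalities for the tower parameters: `0 < σ_m < A ≤ 1`, `σ_m n_m h = A n_m h − 20`,
`1 < Γ_m ≤ γ ≤ 7Γ_m + 7π/h`, `Γ_m ≤ η_m ≤ 2Γ_m`, `Γ_m ≥ m+1`, atoms of level `m` have modulus `≤ 15Γ_m`.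
-/

set_option linter.dupNamespace false

noncomputable section

open scoped ComplexConjugate
open Complex Finset

namespace Summit.RiemannHypothesis.RiemannHypothesis.Theorems.TwoPrimeFoldRigidity.Negative.MBT

/-! ## §2 Tower parameters and level geometry -/

namespace Prm

variable (p : Prm)

/-- `L/(n_m h) ≤ A/2`. -/
theorem depth_le (m : ℕ) : 20 / ((p.nn m : ℝ) * p.h) ≤ p.A / 2 := by
  have hK : 40 / (p.h * p.A) ≤ p.K₀ := by
    have := Nat.le_ceil (40 / (p.h * p.A))
    simp only [K₀]; push_cast; linarith
  have hKn : (p.K₀ : ℝ) ≤ p.nn m := by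
    simp only [nn]; push_cast
    have : (1 : ℝ) ≤ (m : ℝ) + 1 := by linarith [(Nat.cast_nonneg m : (0 : ℝ) ≤ m)]
    nlinarith [show (0 : ℝ) ≤ p.K₀ by positivity]
  have hhA : 0 < p.h * p.A := mul_pos p.hh p.hA
  rw [div_le_iff₀ (mul_pos (p.nn_real_pos m) p.hh)]
  rw [div_le_iff₀ hhA] at hK
  nlinarith [p.hA, p.hh]

/-- abscissae are positive. -/
theorem σ_pos (m : ℕ) : 0 < p.σ m := by
  have := p.depth_le m; simp only [σ]; linarith [p.hA]

/-- abscissae stay strictly below `A` (the supremum is not attained). -/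
theorem σ_lt (m : ℕ) : p.σ m < p.A := by
  have : 0 < 20 / ((p.nn m : ℝ) * p.h) := div_pos (by norm_num) (mul_pos (p.nn_real_pos m) p.hh)
  simp only [σ]; linarith

/-- abscissae are at most `1`. -/
theorem σ_le_one (m : ℕ) : p.σ m ≤ 1 := le_trans (p.σ_lt m).le p.hA1

/-- the key normalisation: `(σ_m − A) n_m h = −L`. -/
theorem σ_mul (m : ℕ) : p.σ m * ((p.nn m : ℝ) * p.h) = p.A * ((p.nn m : ℝ) * p.h) - 20 := by
  have : (p.nn m : ℝ) * p.h ≠ 0 := (mul_pos (p.nn_real_pos m) p.hh).ne'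
  simp only [σ]
  rw [sub_mul, div_mul_cancel₀ _ this]

/-- product form of `Γ_m`. -/
theorem Γ_eq (m : ℕ) : p.Γ m = (2 * (p.nn m : ℝ) * p.P₀) * (Real.pi / p.h) := by
  simp only [Γ]; ring

/-- `π/h > 0`. -/
theorem u_pos : 0 < Real.pi / p.h := div_pos Real.pi_pos p.hh

/-- `Γ_m > 0`. -/
theorem Γ_pos (m : ℕ) : 0 < p.Γ m := by
  rw [p.Γ_eq]
  have := p.nn_real_pos m; have := p.P₀_real_pos; have := p.u_pos
  positivity

/-- `π/h ≤ Γ_m / 2`. -/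
theorem pi_div_le (m : ℕ) : Real.pi / p.h ≤ p.Γ m / 2 := by
  rw [p.Γ_eq]
  have hu := p.u_pos; have := p.one_le_nn m; have := p.one_le_P₀
  have h1 : (1 : ℝ) ≤ (p.nn m : ℝ) * p.P₀ := by nlinarith
  nlinarith

/-- `Γ_m ≥ 1`. -/
theorem one_le_Γ (m : ℕ) : 1 ≤ p.Γ m := by
  rw [p.Γ_eq]
  have hP : 1 < (p.P₀ : ℝ) / p.h := by rw [one_lt_div p.hh]; exact p.h_lt_P₀
  have e : (2 * (p.nn m : ℝ) * p.P₀) * (Real.pi / p.h) = (2 * Real.pi * (p.nn m : ℝ)) * ((p.P₀ : ℝ) / p.h) := by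
    ring
  rw [e]
  have h1 := p.one_le_nn m; have h3 := Real.pi_gt_three
  have h2 : (1 : ℝ) ≤ 2 * Real.pi * (p.nn m : ℝ) := by nlinarith
  nlinarith [mul_le_mul h2 hP.le zero_le_one (by positivity)]

/-- `Γ_m ≥ m + 1` (used for local finiteness). -/
theorem succ_le_Γ (m : ℕ) : (m : ℝ) + 1 ≤ p.Γ m := by
  rw [p.Γ_eq]
  have hP : 1 < (p.P₀ : ℝ) / p.h := by rw [one_lt_div p.hh]; exact p.h_lt_P₀
  have e : (2 * (p.nn m : ℝ) * p.P₀) * (Real.pi / p.h) = (2 * Real.pi * (p.nn m : ℝ)) * ((p.P₀ : ℝ) / p.h) := by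
    ring
  rw [e]
  have hn : (m : ℝ) + 1 ≤ p.nn m := by
    simp only [nn]; push_cast
    have hK : (1 : ℝ) ≤ p.K₀ := by exact_mod_cast p.K₀_pos
    have hm : (0 : ℝ) ≤ (m : ℝ) + 1 := by positivity
    nlinarith
  have := Real.pi_gt_three
  have hm : (0 : ℝ) ≤ (m : ℝ) + 1 := by positivity
  nlinarith [mul_le_mul hn hP.le zero_le_one (by positivity)]

/-- `Γ_m > 1` (heights exceed `1`). -/
theorem one_lt_Γ (m : ℕ) : 1 < p.Γ m := by
  rw [p.Γ_eq]
  have hP : 1 < (p.P₀ : ℝ) / p.h := by rw [one_lt_div p.hh]; exact p.h_lt_P₀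
  have e : (2 * (p.nn m : ℝ) * p.P₀) * (Real.pi / p.h) = (2 * Real.pi * (p.nn m : ℝ)) * ((p.P₀ : ℝ) / p.h) := by
    ring
  rw [e]
  have h1 := p.one_le_nn m; have h3 := Real.pi_gt_three
  have h2 : (1 : ℝ) ≤ 2 * Real.pi * (p.nn m : ℝ) := by nlinarith
  exact lt_of_lt_of_le hP (le_mul_of_one_le_left (by positivity) h2)

/-- `Γ` is monotone in the level. -/
theorem Γ_mono {m' m : ℕ} (h : m' ≤ m) : p.Γ m' ≤ p.Γ m := by
  rw [p.Γ_eq, p.Γ_eq]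
  have hn : (p.nn m' : ℝ) ≤ p.nn m := by
    simp only [nn]; push_cast
    have hK : (0 : ℝ) ≤ p.K₀ := by positivity
    have : (m' : ℝ) ≤ m := by exact_mod_cast h
    nlinarith
  have := p.u_pos; have := p.P₀_real_pos
  gcongr

/-- `η_m = Γ_m + (π/h)/n_m`. -/
theorem η_eq (m : ℕ) : p.η m = p.Γ m + (Real.pi / p.h) / (p.nn m : ℝ) := by
  have := (p.nn_real_pos m).ne'; have := p.hh.ne'
  simp only [η, Γ]
  field_simp

/-- `Γ_m ≤ η_m`. -/
theorem Γ_le_η (m : ℕ) : p.Γ m ≤ p.η m := by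
  rw [p.η_eq]
  have : 0 ≤ (Real.pi / p.h) / (p.nn m : ℝ) := div_nonneg p.u_pos.le (p.nn_real_pos m).le
  linarith

/-- `η_m ≤ 2Γ_m`. -/
theorem η_le (m : ℕ) : p.η m ≤ 2 * p.Γ m := by
  rw [p.η_eq]
  have h1 : (Real.pi / p.h) / (p.nn m : ℝ) ≤ Real.pi / p.h := div_le_self p.u_pos.le (p.one_le_nn m)
  have := p.pi_div_le m
  have := p.Γ_pos m
  linarith

/-- `η_m > 0`. -/
theorem η_pos (m : ℕ) : 0 < p.η m := lt_of_lt_of_le (p.Γ_pos m) (p.Γ_le_η m)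

/-- `β_m > 0`. -/
theorem β_pos (m : ℕ) : 0 < p.β m := by
  simp only [β]; exact div_pos (by positivity) (mul_pos (p.nn_real_pos m) p.hh)

/-- product form of `β_m`. -/
theorem β_eq (m : ℕ) : p.β m = 2 * Real.pi / ((p.nn m : ℝ) * p.h) := rfl

/-- heights of the real quintuple: `γ(inl N) = Γ + N η`. -/
theorem γ_inl (m : ℕ) (N : Fin 5) : p.γ m (Sum.inl N) = p.γ m (Sum.inl 0) + (N : ℕ) * p.η m := by
  have := (p.nn_real_pos m).ne'; have := p.hh.ne'
  simp only [γ, Qn, η, Fin.val_zero]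
  push_cast
  field_simp
  ring

/-- base height of the first real-quintuple gon. -/
theorem γ_inl_zero (m : ℕ) : p.γ m (Sum.inl 0) = p.Γ m := by
  have := (p.nn_real_pos m).ne'; have := p.hh.ne'
  simp only [γ, Qn, Γ, Fin.val_zero]
  push_cast
  field_simp
  ring

/-- heights of the imaginary quintuple: `γ(inr inl N) = Γ + θ + N η`. -/
theorem γ_inr_inl (m : ℕ) (N : Fin 5) :
    p.γ m (Sum.inr (Sum.inl N)) = p.γ m (Sum.inr (Sum.inl 0)) + (N : ℕ) * p.η m := by
  have := (p.nn_real_pos m).ne'; have := p.hh.ne'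
  simp only [γ, Qn, η, Fin.val_zero]
  push_cast
  field_simp
  ring

/-- base height of the first imaginary-quintuple gon. -/
theorem γ_inr_inl_zero (m : ℕ) : p.γ m (Sum.inr (Sum.inl 0)) = p.Γ m + p.θ m := by
  have := (p.nn_real_pos m).ne'; have := p.hh.ne'
  simp only [γ, Qn, Γ, θ, Fin.val_zero]
  push_cast
  field_simp
  ring

/-- product form of the base heights. -/
theorem γ_eq (m : ℕ) (g : G) : p.γ m g = ((p.Qn m g : ℝ) / (2 * (p.nn m : ℝ))) * (Real.pi / p.h) := by
  have := (p.nn_real_pos m).ne'; have := p.hh.ne'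
  simp only [γ]
  field_simp

/-- all base heights are at least `Γ`. -/
theorem Γ_le_γ (m : ℕ) (g : G) : p.Γ m ≤ p.γ m g := by
  have hn := p.nn_real_pos m
  have hQ : (4 * (p.nn m) ^ 2 * p.P₀ : ℕ) ≤ p.Qn m g := by
    rcases g with N | N | u <;> simp only [Qn] <;> omega
  have hQ' : (4 : ℝ) * (p.nn m : ℝ) ^ 2 * p.P₀ ≤ (p.Qn m g : ℝ) := by exact_mod_cast hQ
  rw [p.Γ_eq, p.γ_eq]
  refine mul_le_mul_of_nonneg_right ?_ p.u_pos.le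
  rw [le_div_iff₀ (by positivity)]
  nlinarith

/-- all base heights are at most `7Γ + 7π/h`. -/
theorem γ_le (m : ℕ) (g : G) : p.γ m g ≤ 7 * p.Γ m + 7 * (Real.pi / p.h) := by
  have hn := p.nn_real_pos m; have hn1 := p.one_le_nn m
  have hQ : p.Qn m g ≤ 28 * (p.nn m) ^ 2 * p.P₀ + 13 := by
    rcases g with N | N | u <;> simp only [Qn]
    · have := N.isLt; nlinarith [Nat.zero_le ((p.nn m) ^ 2 * p.P₀)]
    · have := N.isLt; nlinarith [Nat.zero_le ((p.nn m) ^ 2 * p.P₀)]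
    · nlinarith [Nat.zero_le ((p.nn m) ^ 2 * p.P₀)]
  have hQ' : (p.Qn m g : ℝ) ≤ 28 * (p.nn m : ℝ) ^ 2 * p.P₀ + 13 := by exact_mod_cast hQ
  rw [p.Γ_eq, p.γ_eq]
  have e : 7 * ((2 * (p.nn m : ℝ) * p.P₀) * (Real.pi / p.h)) + 7 * (Real.pi / p.h) =
      (14 * (p.nn m : ℝ) * p.P₀ + 7) * (Real.pi / p.h) := by ring
  rw [e]
  refine mul_le_mul_of_nonneg_right ?_ p.u_pos.le
  rw [div_le_iff₀ (by positivity)]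
  nlinarith

/-- every atom of level `m` has modulus at most `15 Γ_m`. -/
theorem norm_atom_le (m : ℕ) (g : G) (j : Fin (p.nn m) × Fin (p.nn m) × Fin (p.nn m)) :
    ‖atom (p.σ m) (p.β m) (p.γ m g) j‖ ≤ 15 * p.Γ m := by
  have hΓ := p.one_le_Γ m
  have hs : (tsumIdx j : ℝ) ≤ 3 * (p.nn m : ℝ) := by
    have h1 := j.1.isLt; have h2 := j.2.1.isLt; have h3 := j.2.2.isLt
    have : tsumIdx j ≤ 3 * p.nn m := by simp only [tsumIdx]; omega
    exact_mod_cast this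
  have hβs : p.β m * (tsumIdx j : ℝ) ≤ 6 * (Real.pi / p.h) := by
    simp only [β]
    rw [div_mul_eq_mul_div, div_le_iff₀ (mul_pos (p.nn_real_pos m) p.hh)]
    have := Real.pi_pos; have := p.hh; have := p.nn_real_pos m
    have e : 6 * (Real.pi / p.h) * ((p.nn m : ℝ) * p.h) = 6 * Real.pi * (p.nn m : ℝ) := by
      field_simp
    rw [e]
    nlinarith
  have him : p.γ m g + p.β m * (tsumIdx j : ℝ) ≤ 14 * p.Γ m := by
    have := p.γ_le m g; have := p.pi_div_le m
    linarith
  have him0 : 0 ≤ p.γ m g + p.β m * (tsumIdx j : ℝ) := by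
    have := p.Γ_le_γ m g; have := p.Γ_pos m
    have : 0 ≤ p.β m * (tsumIdx j : ℝ) := mul_nonneg (p.β_pos m).le (Nat.cast_nonneg _)
    linarith
  calc ‖atom (p.σ m) (p.β m) (p.γ m g) j‖
      ≤ ‖((p.σ m : ℝ) : ℂ)‖ + ‖(((p.γ m g : ℝ) : ℂ) + ((p.β m : ℝ) : ℂ) * ((tsumIdx j : ℕ) : ℂ)) * I‖ :=
        norm_add_le _ _
    _ = p.σ m + (p.γ m g + p.β m * (tsumIdx j : ℝ)) := by
        rw [Complex.norm_real, Real.norm_of_nonneg (p.σ_pos m).le, norm_mul, Complex.norm_I, mul_one]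
        have : (((p.γ m g : ℝ) : ℂ) + ((p.β m : ℝ) : ℂ) * ((tsumIdx j : ℕ) : ℂ)) =
            ((p.γ m g + p.β m * (tsumIdx j : ℝ) : ℝ) : ℂ) := by push_cast; ring
        rw [this, Complex.norm_real, Real.norm_of_nonneg him0]
    _ ≤ 1 + 14 * p.Γ m := by linarith [p.σ_le_one m]
    _ ≤ 15 * p.Γ m := by linarith

/-- imaginary part of an atom. -/
theorem im_atom (m : ℕ) (g : G) (j : Fin (p.nn m) × Fin (p.nn m) × Fin (p.nn m)) :
    (atom (p.σ m) (p.β m) (p.γ m g) j).im = p.γ m g + p.β m * (tsumIdx j : ℝ) := by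
  simp [atom, Complex.add_im, Complex.mul_im]

/-- real part of an atom is the level abscissa. -/
theorem re_atom (m : ℕ) (g : G) (j : Fin (p.nn m) × Fin (p.nn m) × Fin (p.nn m)) :
    (atom (p.σ m) (p.β m) (p.γ m g) j).re = p.σ m := by
  simp [atom, Complex.add_re, Complex.mul_re]

/-- atoms lie at height `≥ Γ_m`. -/
theorem Γ_le_im_atom (m : ℕ) (g : G) (j : Fin (p.nn m) × Fin (p.nn m) × Fin (p.nn m)) :
    p.Γ m ≤ (atom (p.σ m) (p.β m) (p.γ m g) j).im := by
  rw [p.im_atom]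
  have := p.Γ_le_γ m g
  have : 0 ≤ p.β m * (tsumIdx j : ℝ) := mul_nonneg (p.β_pos m).le (Nat.cast_nonneg _)
  linarith

/-- `|W_r(g)| ≤ (15Γ_m)^r`. -/
theorem norm_W_le (m : ℕ) (g : G) (r : ℕ) : ‖p.W m g r‖ ≤ (15 * p.Γ m) ^ r :=
  norm_Wm_le (p.nn_ne_zero m) _ _ _ _ r (p.norm_atom_le m g)

end Prm

end Summit.RiemannHypothesis.RiemannHypothesis.Theorems.TwoPrimeFoldRigidity.Negative.MBT
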